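import Mathlib
import HarnessLib

set_option autoImplicit false

/-!
# The `θ`-isotypic Fourier transfer on a finite commutative group (character orthogonality over any field
# with enough roots of unity; smoothing, push-forward and the ultrametric assembly inequality)

Topic `GroupTheory/FiniteAbelian` (namespace = path).  THEOREM-ONLY file (no named fact, no `sorry`, no `def`):
port **P61 (b)** of the stub-critic's plan of record for crux `stmt-BirchSwinnertonDyer-27851`
(`PrintCf2.SplitBadTwoLowerHalfOfFacts`, STUB-PLAN v7.9 row 129 = R225 «THE LEVEL DECIDES — ROAD A″», critic rows
`CRITIC-ROWS-g44.md` rev 4), i.e. §B–§D (+ the two instances §F) of the rc-0 sketch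
`Summits/BirchSwinnertonDyer/BirchSwinnertonDyer/Cruxes/SplitBadTwoLowerHalfOfFacts/STUB_IDEAS_stub_heegnerIndexLowerAtTwo_3_g44.lean`
(sidea-3 g44, sha16 `cf5257772f1a255e`, namespace `…LevelTransferK3G44`), re-homed here under generic names.  Written by
the typer seat `bsd-print-cf2-ty2` (generation 46).  Consumers: the finite-level receptacle of de Shalit's
II.5.2 (4) at `p = 2` (`Summits/BirchSwinnertonDyer/Rank1Residual/P2/…`), where `G = Gal(K(𝔣₀v̄^m vⁿ)/K)`, `I` = inertia
at `v`, `θ` = the frame's inertia type, `𝕜 = ℂ` or `ℂ₂`.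

## The mathematics (Mathlib inputs only)

Let `G` be a finite commutative group and `𝕜` a field of characteristic `0` with enough `exp G`-th roots of unity, so
that `Ĝ := Hom(G, 𝕜ˣ)` separates points (Mathlib `CommGroup.exists_apply_ne_one_of_hasEnoughRootsOfUnity`).

* §1 Orthogonality: `Σ_χ χ(x) = 0` for `x ≠ 1` (`sum_dual_apply_eq_zero`; the generic-field twin of the tree's
  `ℂ`-valued `AlgebraicGeometry.HodgeTheory.….sum_monoidHom_apply_eq_zero`, of the `𝔽_p`-valued
  `GroupTheory.FiniteAbelian.sum_monoidHom_apply_eq_zero` above in this topic, and of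
  `AlgebraicGeometry.CossartPiltant200819.….sum_monoidHom_apply_eq_zero`), `Σ_χ χ(σ)χ(τ)⁻¹ = |Ĝ|·[σ = τ]`
  (`sum_dual_apply_mul_inv`), Fourier injectivity (`eq_zero_of_forall_charCoeff_eq_zero`), and row orthogonality on a
  subgroup `I` against a type `θ : I → 𝕜ˣ` (`sum_subgroup_typeRatio`).
* §2 ★ `isotypic_transfer` — if `F : G → 𝕜` has `I`-type `θ⁻¹` (`F(hσ) = θ(h)⁻¹F(σ)`) and the masses `ν` satisfy, FOR
  THE TYPE-`θ` CHARACTERS ONLY, `Σ_σ χ(σ)⁻¹ν(σ) = c·χ(γ₀)⁻¹·Σ_g χ(g)L(g)`, then `Σ_σ F(σ)ν(σ) = c·Σ_g F(γ₀g⁻¹)L(g)`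
  EXACTLY (the `|G|` of Fourier inversion and the `|I|` of the isotypic projector cancel inside the proof).
* §3 Smoothing and push-forward on the finite level (`charSum_smoothing`, `sum_mul_apply_eq_sum_fiber`,
  `norm_fiberMass_le`, `norm_sum_translate_sub_smul_le`).
* §4 The ultrametric assembly inequality `norm_le_of_transfer` and the digit bookkeeping `residual_iff_digits[_one]`.
* §5 The `ℂ` and `ℂ₂` instances of §2.

## References

* J.-P. Serre, *Linear Representations of Finite Groups*, GTM 42 (1977): §2.3 Thm. 3 (p. 15) and §2.5 Prop. 7 (p. 20)
  (orthogonality relations), §2.6 Thm. 8 (ii) (p. 21) (the isotypic projector `p_i = (n_i/g) Σ_t χ_i(t)^* ρ_t`), §3.1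
  (abelian groups: all irreducible representations have degree `1`). [SerreLinearRepresentations1977]
* E. de Shalit, *Iwasawa Theory of Elliptic Curves with Complex Multiplication* (1987), I.3.1 (p. 16), II.4.12 (31)–(33)
  (p. 66–69), II.5.2 (4) (p. 79) — where §2–§4 are consumed. [deShalit1987]
* Mathlib `GroupTheory/FiniteAbelian/Duality`.
-/

open Finset

namespace Literature.GroupTheory.FiniteAbelian

/-! ## §1 Orthogonality over a field with enough roots of unity -/

section IsotypicFourier

variable {𝕜 : Type*} [Field 𝕜] [CharZero 𝕜]
variable {G : Type*} [CommGroup G] [Fintype G] [DecidableEq G]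
variable [Fintype (G →* 𝕜ˣ)] [HasEnoughRootsOfUnity 𝕜 (Monoid.exponent G)]

omit [CharZero 𝕜] [DecidableEq G] in
/-- **Column orthogonality**: `Σ_χ χ(x) = 0` for `x ≠ 1` (duality gives `φ` with `φ x ≠ 1`; multiplication by `φ`
permutes the characters).  Generic-field form of the tree's `ℂ`-valued / `𝔽_p`-valued `sum_monoidHom_apply_eq_zero`.
[cite: SerreLinearRepresentations1977, §2.5 Prop. 7 (p. 20)] -/
theorem sum_dual_apply_eq_zero {x : G} (hx : x ≠ 1) : ∑ χ : G →* 𝕜ˣ, (χ x : 𝕜) = 0 := by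
  obtain ⟨φ, hφ⟩ := CommGroup.exists_apply_ne_one_of_hasEnoughRootsOfUnity G 𝕜 hx
  set S := ∑ χ : G →* 𝕜ˣ, (χ x : 𝕜) with hS_def
  have hS : (φ x : 𝕜) * S = S := by
    rw [hS_def, Finset.mul_sum]
    exact Fintype.sum_bijective (φ * ·) (Group.mulLeft_bijective φ) _ _ fun χ ↦ by
      rw [MonoidHom.mul_apply, Units.val_mul]
  have hφ' : (φ x : 𝕜) ≠ 1 := by rwa [Ne, Units.val_eq_one]
  have h0 : ((φ x : 𝕜) - 1) * S = 0 := by rw [sub_mul, one_mul, hS, sub_self]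
  rcases mul_eq_zero.mp h0 with h1 | h1
  · exact absurd (sub_eq_zero.mp h1) hφ'
  · exact h1

omit [CharZero 𝕜] in
/-- `Σ_χ χ(σ)·χ(τ)⁻¹ = |Ĝ|·[σ = τ]`. [cite: SerreLinearRepresentations1977, §2.5 Prop. 7 (p. 20)] -/
theorem sum_dual_apply_mul_inv (σ τ : G) :
    ∑ χ : G →* 𝕜ˣ, (χ σ : 𝕜) * (χ τ : 𝕜)⁻¹ = if σ = τ then (Fintype.card (G →* 𝕜ˣ) : 𝕜) else 0 := by
  have key : ∀ χ : G →* 𝕜ˣ, (χ σ : 𝕜) * (χ τ : 𝕜)⁻¹ = (χ (σ * τ⁻¹) : 𝕜) := fun χ ↦ by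
    rw [map_mul, map_inv, Units.val_mul, Units.val_inv_eq_inv_val]
  simp_rw [key]
  split_ifs with h
  · subst h
    simp [Finset.card_univ]
  · exact sum_dual_apply_eq_zero (fun h' ↦ h (mul_inv_eq_one.mp h'))

/-- **Fourier injectivity**: a function all of whose character coefficients `Σ_σ χ(σ)⁻¹ f(σ)` vanish is zero
(`|Ĝ| ≠ 0` in characteristic `0`). [cite: SerreLinearRepresentations1977, §2.5 Prop. 7 (p. 20), §3.1 (p. 25)] -/
theorem eq_zero_of_forall_charCoeff_eq_zero (f : G → 𝕜)
    (hf : ∀ χ : G →* 𝕜ˣ, ∑ σ, (χ σ : 𝕜)⁻¹ * f σ = 0) : f = 0 := by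
  funext σ
  have h : ∑ χ : G →* 𝕜ˣ, (χ σ : 𝕜) * ∑ τ, (χ τ : 𝕜)⁻¹ * f τ = 0 := by simp [hf]
  have h' : ∑ χ : G →* 𝕜ˣ, (χ σ : 𝕜) * ∑ τ, (χ τ : 𝕜)⁻¹ * f τ =
      ∑ τ, f τ * ∑ χ : G →* 𝕜ˣ, (χ σ : 𝕜) * (χ τ : 𝕜)⁻¹ := by
    simp_rw [Finset.mul_sum]
    rw [Finset.sum_comm]
    refine Finset.sum_congr rfl fun τ _ ↦ Finset.sum_congr rfl fun χ _ ↦ ?_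
    ring
  rw [h'] at h
  simp_rw [sum_dual_apply_mul_inv] at h
  simp only [mul_ite, mul_zero, Finset.sum_ite_eq, Finset.mem_univ, if_true] at h
  have hcard : (Fintype.card (G →* 𝕜ˣ) : 𝕜) ≠ 0 := Nat.cast_ne_zero.mpr Fintype.card_ne_zero
  simpa [hcard] using h

variable (I : Subgroup G) [DecidablePred (· ∈ I)]

omit [CharZero 𝕜] [DecidableEq G] [Fintype (G →* 𝕜ˣ)] [HasEnoughRootsOfUnity 𝕜 (Monoid.exponent G)] in
/-- **Row orthogonality on a subgroup against a type**: `Σ_{h ∈ I} θ(h)⁻¹χ(h) = |I|` if `χ|_I = θ`, `0` otherwise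
(Mathlib `sum_hom_units_eq_zero`). [cite: SerreLinearRepresentations1977, §2.3 Thm. 3 (p. 15)] -/
theorem sum_subgroup_typeRatio (θ : I →* 𝕜ˣ) (χ : G →* 𝕜ˣ) [Decidable (χ.comp I.subtype = θ)] :
    ∑ h : I, (θ h : 𝕜)⁻¹ * (χ (h : G) : 𝕜) =
      if χ.comp I.subtype = θ then (Fintype.card I : 𝕜) else 0 := by
  split_ifs with hc
  · have h1 : ∀ h : I, (θ h : 𝕜)⁻¹ * (χ (h : G) : 𝕜) = 1 := fun h ↦ by
      have : χ (h : G) = θ h := by rw [← hc]; rfl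
      rw [this, inv_mul_cancel₀ (Units.ne_zero _)]
    simp [h1, Finset.card_univ]
  · set ψ : I →* 𝕜ˣ := θ⁻¹ * χ.comp I.subtype with hψ_def
    have hψ : ∀ h : I, (θ h : 𝕜)⁻¹ * (χ (h : G) : 𝕜) = ((Units.coeHom 𝕜).comp ψ) h := fun h ↦ by
      simp [hψ_def, Units.val_mul]
    have hne : (Units.coeHom 𝕜).comp ψ ≠ 1 := by
      intro h1
      apply hc
      ext h
      have h2 : (θ h : 𝕜)⁻¹ * (χ (h : G) : 𝕜) = 1 := by
        rw [hψ h, h1, MonoidHom.one_apply]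
      have hθ : (θ h : 𝕜) ≠ 0 := Units.ne_zero _
      have h3 : (χ (h : G) : 𝕜) = (θ h : 𝕜) := by
        have := congrArg ((θ h : 𝕜) * ·) h2
        simpa [← mul_assoc, mul_inv_cancel₀ hθ] using this
      simp only [MonoidHom.coe_comp, Subgroup.coe_subtype, Function.comp_apply]
      exact h3
    simp_rw [hψ]
    exact sum_hom_units_eq_zero _ hne

/-! ## §2 The `θ`-isotypic Fourier transfer -/

/-- **THE `θ`-ISOTYPIC FOURIER TRANSFER** (division-free in its statement).  If `F : G → 𝕜` has `I`-type `θ⁻¹`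
(`F(hσ) = θ(h)⁻¹F(σ)` for `h ∈ I`) and the masses `ν` satisfy, for the characters `χ` with `χ|_I = θ` only,
`Σ_σ χ(σ)⁻¹ν(σ) = c·χ(γ₀)⁻¹·Σ_g χ(g)L(g)`, then `Σ_σ F(σ)ν(σ) = c·Σ_g F(γ₀g⁻¹)L(g)`.  Proof: `ν` and the model
masses `ρ(τ) = c·L(γ₀τ⁻¹)` have the same type-`θ` coefficients; the `θ`-projection of `ν − ρ` then has ALL coefficients
zero (row orthogonality on `I`), hence vanishes (Fourier injectivity), and `|I|·Σ F·(ν − ρ) = Σ F·(ν − ρ)_θ = 0`.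
In the consumer `G = Gal(K(𝔣₀v̄^m vⁿ)/K)`, `I` = inertia at `v`, `c·χ(γ₀)⁻¹` = the Gauss factor of the type-`θ`
characters, `L g = log j₂(g·u)`: the `F`-weighted mass sum IS `c` times the `F`-twisted regulator sum of ONE unit.
[cite: SerreLinearRepresentations1977, §2.6 Thm. 8 (ii) (p. 21)] [cite: deShalit1987, II.5.2 (4) (p. 79), II.4.12 (31)–(33) (p. 66–68)] -/
theorem isotypic_transfer (θ : I →* 𝕜ˣ) (F ν L : G → 𝕜) (c : 𝕜) (γ₀ : G)
    (hF : ∀ (h : I) (σ : G), F ((h : G) * σ) = (θ h : 𝕜)⁻¹ * F σ)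
    (hν : ∀ χ : G →* 𝕜ˣ, χ.comp I.subtype = θ →
      ∑ σ, (χ σ : 𝕜)⁻¹ * ν σ = c * (χ γ₀ : 𝕜)⁻¹ * ∑ g, (χ g : 𝕜) * L g) :
    ∑ σ, F σ * ν σ = c * ∑ g, F (γ₀ * g⁻¹) * L g := by
  classical
  -- the reindexing involution `g ↦ γ₀ g⁻¹`
  have h1 : ∀ g : G, γ₀ * (γ₀ * g⁻¹)⁻¹ = g := fun g ↦ by
    rw [mul_inv_rev, inv_inv, mul_comm g, mul_inv_cancel_left]
  have hinv : Function.Involutive (fun g : G ↦ γ₀ * g⁻¹) := fun g ↦ h1 g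
  -- the model masses `ρ τ = c · L(γ₀ τ⁻¹)`
  set ρ : G → 𝕜 := fun τ ↦ c * L (γ₀ * τ⁻¹) with hρ_def
  have hρg : ∀ g : G, ρ (γ₀ * g⁻¹) = c * L g := fun g ↦ by
    show c * L (γ₀ * (γ₀ * g⁻¹)⁻¹) = c * L g
    rw [h1]
  have hχg : ∀ (χ : G →* 𝕜ˣ) (g : G), (χ (γ₀ * g⁻¹) : 𝕜)⁻¹ = (χ γ₀ : 𝕜)⁻¹ * (χ g : 𝕜) := fun χ g ↦ by
    rw [map_mul, map_inv, Units.val_mul, Units.val_inv_eq_inv_val, mul_inv, inv_inv]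
  have hρ : ∀ χ : G →* 𝕜ˣ,
      ∑ σ, (χ σ : 𝕜)⁻¹ * ρ σ = c * (χ γ₀ : 𝕜)⁻¹ * ∑ g, (χ g : 𝕜) * L g := by
    intro χ
    rw [Finset.mul_sum]
    refine (Function.Bijective.sum_comp hinv.bijective (fun σ ↦ (χ σ : 𝕜)⁻¹ * ρ σ)).symm.trans ?_
    refine Finset.sum_congr rfl fun g _ ↦ ?_
    rw [hχg, hρg]
    ring
  -- `D = ν − ρ` has vanishing coefficients at the type-`θ` characters
  have hD : ∀ χ : G →* 𝕜ˣ, χ.comp I.subtype = θ → ∑ σ, (χ σ : 𝕜)⁻¹ * (ν σ - ρ σ) = 0 := by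
    intro χ hχ
    simp only [mul_sub, Finset.sum_sub_distrib, hν χ hχ, hρ χ, sub_self]
  -- its `θ`-projection `Dθ σ = Σ_{h ∈ I} θ(h)⁻¹ D(hσ)` has ALL coefficients zero, hence vanishes
  set Dθ : G → 𝕜 := fun σ ↦ ∑ h : I, (θ h : 𝕜)⁻¹ * (ν ((h : G) * σ) - ρ ((h : G) * σ)) with hDθ_def
  have hcoeff : ∀ χ : G →* 𝕜ˣ, ∑ σ, (χ σ : 𝕜)⁻¹ * Dθ σ = 0 := by
    intro χ
    have hswap : ∑ σ, (χ σ : 𝕜)⁻¹ * Dθ σ =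
        ∑ h : I, (θ h : 𝕜)⁻¹ * (χ (h : G) : 𝕜) * ∑ τ, (χ τ : 𝕜)⁻¹ * (ν τ - ρ τ) := by
      simp only [hDθ_def, Finset.mul_sum]
      rw [Finset.sum_comm]
      refine Finset.sum_congr rfl fun h _ ↦ ?_
      -- reindex `τ = h σ`
      refine (Fintype.sum_bijective (fun σ ↦ (h : G) * σ) (Group.mulLeft_bijective (h : G)) _ _ fun σ ↦ ?_)
      have hχ : (χ ((h : G) * σ) : 𝕜)⁻¹ = (χ (h : G) : 𝕜)⁻¹ * (χ σ : 𝕜)⁻¹ := by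
        rw [map_mul, Units.val_mul, mul_inv]
      rw [hχ]
      have hh : (χ (h : G) : 𝕜) * (χ (h : G) : 𝕜)⁻¹ = 1 := mul_inv_cancel₀ (Units.ne_zero _)
      linear_combination
        (-((θ h : 𝕜)⁻¹ * (χ σ : 𝕜)⁻¹ * (ν ((h : G) * σ) - ρ ((h : G) * σ)))) * hh
    rw [hswap, ← Finset.sum_mul, sum_subgroup_typeRatio I θ χ]
    split_ifs with hχ
    · rw [hD χ hχ, mul_zero]
    · rw [zero_mul]
  have hDθ0 : Dθ = 0 := eq_zero_of_forall_charCoeff_eq_zero Dθ hcoeff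
  -- `|I| · Σ F·D = Σ F·Dθ = 0`
  have hT : (Fintype.card I : 𝕜) * ∑ σ, F σ * (ν σ - ρ σ) = ∑ σ, F σ * Dθ σ := by
    have step : ∀ h : I, ∑ σ, F σ * (ν σ - ρ σ) =
        ∑ σ, (θ h : 𝕜)⁻¹ * F σ * (ν ((h : G) * σ) - ρ ((h : G) * σ)) := by
      intro h
      symm
      refine Fintype.sum_bijective (fun σ ↦ (h : G) * σ) (Group.mulLeft_bijective (h : G)) _ _ fun σ ↦ ?_
      rw [hF h σ]
    calc (Fintype.card I : 𝕜) * ∑ σ, F σ * (ν σ - ρ σ)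
        = ∑ h : I, ∑ σ, F σ * (ν σ - ρ σ) := by simp [Finset.card_univ]
      _ = ∑ h : I, ∑ σ, (θ h : 𝕜)⁻¹ * F σ * (ν ((h : G) * σ) - ρ ((h : G) * σ)) :=
          Finset.sum_congr rfl fun h _ ↦ step h
      _ = ∑ σ, F σ * Dθ σ := by
          rw [Finset.sum_comm]
          refine Finset.sum_congr rfl fun σ _ ↦ ?_
          simp only [hDθ_def, Finset.mul_sum]
          refine Finset.sum_congr rfl fun h _ ↦ ?_
          ring
  have hI : (Fintype.card I : 𝕜) ≠ 0 := Nat.cast_ne_zero.mpr Fintype.card_ne_zero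
  have hT0 : ∑ σ, F σ * (ν σ - ρ σ) = 0 := by
    have : (Fintype.card I : 𝕜) * ∑ σ, F σ * (ν σ - ρ σ) = 0 := by
      rw [hT, hDθ0]; simp
    exact (mul_eq_zero.mp this).resolve_left hI
  have hνρ : ∑ σ, F σ * ν σ = ∑ σ, F σ * ρ σ := by
    simpa [mul_sub, Finset.sum_sub_distrib, sub_eq_zero] using hT0
  -- conclude by the same reindexing
  rw [hνρ, Finset.mul_sum]
  refine (Function.Bijective.sum_comp hinv.bijective (fun σ ↦ F σ * ρ σ)).symm.trans ?_
  refine Finset.sum_congr rfl fun g _ ↦ ?_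
  rw [hρg]
  ring

end IsotypicFourier

/-! ## §3 Smoothing and push-forward on the finite level -/

section Smoothing

variable {𝕜 : Type*} [Field 𝕜] {G : Type*} [CommGroup G] [Fintype G]

/-- **Smoothing on the character side is exact**: for the translated-and-scaled masses `ν g = w·(μ̄(a⁻¹g) − N·μ̄ g)`
(`w = 12`, `a = σ_𝔞`, `N = N𝔞`), `Σ_g χ(g)⁻¹ ν(g) = w·(χ(a)⁻¹ − N)·Σ_g χ(g)⁻¹ μ̄(g)` — the left-hand side of de Shalit's
coset-value identity (`12·(χ(σ_𝔞)⁻¹ − N𝔞)·∫χ̂⁻¹dμ`) read on level masses.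
[cite: deShalit1987, II.4.12 (p. 67–69), II.5.2 (4) (p. 79)] -/
theorem charSum_smoothing (μbar : G → 𝕜) (a : G) (w N : 𝕜) (χ : G →* 𝕜ˣ) :
    ∑ g, (χ g : 𝕜)⁻¹ * (w * (μbar (a⁻¹ * g) - N * μbar g)) =
      w * ((χ a : 𝕜)⁻¹ - N) * ∑ g, (χ g : 𝕜)⁻¹ * μbar g := by
  classical
  have h1 : ∑ g, (χ g : 𝕜)⁻¹ * μbar (a⁻¹ * g) = (χ a : 𝕜)⁻¹ * ∑ g, (χ g : 𝕜)⁻¹ * μbar g := by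
    rw [Finset.mul_sum]
    refine (Fintype.sum_bijective (fun g ↦ a * g) (Group.mulLeft_bijective a) _ _ fun g ↦ ?_).symm
    rw [inv_mul_cancel_left, map_mul, Units.val_mul, mul_inv]
    ring
  have h2 : ∑ g, (χ g : 𝕜)⁻¹ * (w * (μbar (a⁻¹ * g) - N * μbar g)) =
      w * ∑ g, (χ g : 𝕜)⁻¹ * μbar (a⁻¹ * g) - w * N * ∑ g, (χ g : 𝕜)⁻¹ * μbar g := by
    simp only [mul_sub, Finset.sum_sub_distrib, Finset.mul_sum]
    congr 1 <;> refine Finset.sum_congr rfl fun g _ ↦ by ring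
  rw [h2, h1]
  ring

/-- **Push-forward of level masses along the fibres** (`Λ(G, M) = lim← M[G/H]`: the level-`H′` masses of a
distribution pushed forward to `G/H` are its level-`H` masses): a weighted sum whose weight-function factors through
`p : A → Q` is the sum over `Q` against the fibre masses `Σ_{p a = q} w a`. [cite: deShalit1987, I.3.1 (p. 15–16)] -/
theorem sum_mul_apply_eq_sum_fiber {A Q : Type*} [Fintype A] [Fintype Q] [DecidableEq Q]
    (w : A → 𝕜) (p : A → Q) (φ : Q → 𝕜) :
    ∑ a, w a * φ (p a) = ∑ q, (∑ a ∈ Finset.univ.filter (fun a ↦ p a = q), w a) * φ q := by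
  rw [← Finset.sum_fiberwise_of_maps_to (s := Finset.univ) (t := Finset.univ) (g := p)
    (fun a _ ↦ Finset.mem_univ _)]
  refine Finset.sum_congr rfl fun q _ ↦ ?_
  rw [Finset.sum_mul]
  refine Finset.sum_congr rfl fun a ha ↦ ?_
  rw [(Finset.mem_filter.mp ha).2]

end Smoothing

section SmoothingNorm

variable {𝕜 : Type*} [NormedField 𝕜] [IsUltrametricDist 𝕜] {G : Type*} [CommGroup G] [Fintype G]

/-- **Fibre masses stay bounded** (ultrametric): if every level mass has norm `≤ B` then so does every fibre mass
`Σ_{p a = q} w a`. [cite: deShalit1987, I.3.1 (p. 16)] -/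
theorem norm_fiberMass_le {A Q : Type*} [Fintype A] [DecidableEq Q] (w : A → 𝕜) (p : A → Q) {B : ℝ}
    (hB : 0 ≤ B) (hw : ∀ a, ‖w a‖ ≤ B) (q : Q) :
    ‖∑ a ∈ Finset.univ.filter (fun a ↦ p a = q), w a‖ ≤ B :=
  IsUltrametricDist.norm_sum_le_of_forall_le_of_nonneg hB fun a _ ↦ hw a

/-- **Smoothing on the `F`-side costs only the oscillation of `F`**: if `F(a·g) = φ·F(g)` up to `ε` and the masses
are `≤ B`, then `‖Σ_g F(g)·μ̄(a⁻¹g) − φ·Σ_g F(g)·μ̄(g)‖ ≤ ε·B`. [cite: deShalit1987, I.3.1 (p. 16), II.4.12 (p. 67)] -/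
theorem norm_sum_translate_sub_smul_le (F μbar : G → 𝕜) (a : G) (φ : 𝕜) {ε B : ℝ} (hε : 0 ≤ ε)
    (hB : 0 ≤ B) (hF : ∀ g, ‖F (a * g) - φ * F g‖ ≤ ε) (hμ : ∀ g, ‖μbar g‖ ≤ B) :
    ‖∑ g, F g * μbar (a⁻¹ * g) - φ * ∑ g, F g * μbar g‖ ≤ ε * B := by
  classical
  have h1 : ∑ g, F g * μbar (a⁻¹ * g) = ∑ g, F (a * g) * μbar g :=
    (Fintype.sum_bijective (fun g ↦ a * g) (Group.mulLeft_bijective a) _ _ fun g ↦ by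
      rw [inv_mul_cancel_left]).symm
  rw [h1, Finset.mul_sum, ← Finset.sum_sub_distrib]
  refine IsUltrametricDist.norm_sum_le_of_forall_le_of_nonneg (mul_nonneg hε hB) fun g _ ↦ ?_
  rw [show F (a * g) * μbar g - φ * (F g * μbar g) = (F (a * g) - φ * F g) * μbar g by ring, norm_mul]
  exact mul_le_mul (hF g) (hμ g) (norm_nonneg _) hε

end SmoothingNorm

/-! ## §4 The assembly inequality (ultrametric) and its digit bookkeeping -/

section Assembly

variable {𝕜 : Type*} [NormedField 𝕜] [IsUltrametricDist 𝕜]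

/-- Ultrametric inequality for differences. [folklore] -/
private theorem norm_sub_le_max' (x y : 𝕜) : ‖x - y‖ ≤ max ‖x‖ ‖y‖ := by
  simpa [sub_eq_add_neg, norm_neg] using IsUltrametricDist.norm_add_le_max x (-y)

/-- **THE ASSEMBLY (glue of the four pieces, ultrametric).**  `Iv = ∫ r·l dμ`; `S₁` = the level sum of `r·l` against
the witness's pushed-forward masses (`‖Iv − S₁‖ ≤ R`); `S₂` = the same sum against the smoothed masses,
`S₂ = κ·S₁ + E` with `κ ≠ 0` and `‖E‖ ≤ ‖κ‖·R`; `S₂ = c·𝔖` (§2, `c` = Gauss constant, `𝔖` = twisted regulator sum).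
Then the ONE residual inequality `‖c·𝔖‖ ≤ ‖κ‖·R` gives `‖Iv‖ ≤ R`. [cite: deShalit1987, II.5.2 (4) (p. 79)] -/
theorem norm_le_of_transfer {Iv S₁ S₂ E 𝔖 κ c : 𝕜} {R : ℝ} (hκ : κ ≠ 0)
    (h1 : ‖Iv - S₁‖ ≤ R) (h2 : S₂ = κ * S₁ + E) (h3 : ‖E‖ ≤ ‖κ‖ * R) (h4 : S₂ = c * 𝔖)
    (h5 : ‖c * 𝔖‖ ≤ ‖κ‖ * R) : ‖Iv‖ ≤ R := by
  have hS₁ : S₁ = κ⁻¹ * (S₂ - E) := by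
    rw [h2]; field_simp; ring
  have hS₁n : ‖S₁‖ ≤ R := by
    rw [hS₁, norm_mul, norm_inv]
    have : ‖S₂ - E‖ ≤ ‖κ‖ * R :=
      (norm_sub_le_max' _ _).trans (max_le (h4 ▸ h5) h3)
    calc ‖κ‖⁻¹ * ‖S₂ - E‖ ≤ ‖κ‖⁻¹ * (‖κ‖ * R) := by gcongr
      _ = R := by field_simp
  calc ‖Iv‖ = ‖(Iv - S₁) + S₁‖ := by rw [sub_add_cancel]
    _ ≤ max ‖Iv - S₁‖ ‖S₁‖ := IsUltrametricDist.norm_add_le_max _ _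
    _ ≤ R := max_le h1 hS₁n

omit [IsUltrametricDist 𝕜] in
/-- **Digit bookkeeping** (general smoothing digit `s ≥ 1`): with `‖κ‖ = 2^{−(2 + s)}` and `‖c‖ = 2^{n/2}` the residual
inequality `‖c·𝔖‖ ≤ ‖κ‖·2^{−M/2}` is `‖𝔖‖ ≤ 2^{−(M/2 + 2 + s + n/2)}`.
[cite: deShalit1987, II.4.8 (19), II.4.12 (31), II.5.2 (4) (p. 79)] -/
theorem residual_iff_digits {𝔖 κ c : 𝕜} {M n s : ℝ} (hκ : ‖κ‖ = (2 : ℝ) ^ (-(2 + s)))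
    (hc : ‖c‖ = (2 : ℝ) ^ (n / 2)) :
    ‖c * 𝔖‖ ≤ ‖κ‖ * (2 : ℝ) ^ (-M / 2) ↔ ‖𝔖‖ ≤ (2 : ℝ) ^ (-(M / 2 + 2 + s + n / 2)) := by
  have h2 : (0 : ℝ) < 2 := by norm_num
  have hcpos : 0 < (2 : ℝ) ^ (n / 2) := Real.rpow_pos_of_pos h2 _
  rw [norm_mul, hc, hκ]
  rw [show (2 : ℝ) ^ (-(M / 2 + 2 + s + n / 2))
      = (2 : ℝ) ^ (-(2 + s)) * (2 : ℝ) ^ (-M / 2) / (2 : ℝ) ^ (n / 2) by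
    rw [← Real.rpow_add h2, ← Real.rpow_sub h2]; congr 1; ring]
  rw [le_div_iff₀ hcpos, mul_comm]

omit [IsUltrametricDist 𝕜] in
/-- The generic case `s = 1`: threshold `M/2 + 3 + n/2`. [cite: deShalit1987, II.5.2 (4) (p. 79)] -/
theorem residual_iff_digits_one {𝔖 κ c : 𝕜} {M n : ℝ} (hκ : ‖κ‖ = (2 : ℝ) ^ (-(3 : ℝ)))
    (hc : ‖c‖ = (2 : ℝ) ^ (n / 2)) :
    ‖c * 𝔖‖ ≤ ‖κ‖ * (2 : ℝ) ^ (-M / 2) ↔ ‖𝔖‖ ≤ (2 : ℝ) ^ (-(M / 2 + 3 + n / 2)) := by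
  have h := residual_iff_digits (𝔖 := 𝔖) (M := M) (n := n) (s := 1) (by rw [hκ]; norm_num) hc
  rw [show -(M / 2 + 2 + 1 + n / 2) = -(M / 2 + 3 + n / 2) by ring] at h
  exact h

end Assembly

/-! ## §5 The `ℂ`- and `ℂ₂`-valued instances of §2 -/

section ComplexInstance

variable {G : Type*} [CommGroup G] [Fintype G] [DecidableEq G] [Fintype (G →* ℂˣ)]

/-- §2 over `ℂ`: Mathlib's `HasEnoughRootsOfUnity ℂ (exponent G)` instance (algebraically closed, characteristic zero)
discharges the duality hypothesis. [cite: SerreLinearRepresentations1977, §2.6 Thm. 8 (ii) (p. 21)] -/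
theorem isotypic_transfer_complex (I : Subgroup G) [DecidablePred (· ∈ I)] (θ : I →* ℂˣ)
    (F ν L : G → ℂ) (c : ℂ) (γ₀ : G)
    (hF : ∀ (h : I) (σ : G), F ((h : G) * σ) = (θ h : ℂ)⁻¹ * F σ)
    (hν : ∀ χ : G →* ℂˣ, χ.comp I.subtype = θ →
      ∑ σ, (χ σ : ℂ)⁻¹ * ν σ = c * (χ γ₀ : ℂ)⁻¹ * ∑ g, (χ g : ℂ) * L g) :
    ∑ σ, F σ * ν σ = c * ∑ g, F (γ₀ * g⁻¹) * L g :=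
  isotypic_transfer I θ F ν L c γ₀ hF hν

end ComplexInstance

section PadicComplexInstance

variable {G : Type*} [CommGroup G] [Fintype G] [DecidableEq G] [Fintype (G →* ℂ_[2]ˣ)]

/-- §2 over `ℂ₂` (algebraically closed of characteristic `0`, so the duality hypothesis is discharged once
`exponent G ≠ 0` in `ℂ₂` is registered). [cite: SerreLinearRepresentations1977, §2.6 Thm. 8 (ii) (p. 21)] -/
theorem isotypic_transfer_padicComplex (I : Subgroup G) [DecidablePred (· ∈ I)] (θ : I →* ℂ_[2]ˣ)
    (F ν L : G → ℂ_[2]) (c : ℂ_[2]) (γ₀ : G)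
    (hF : ∀ (h : I) (σ : G), F ((h : G) * σ) = (θ h : ℂ_[2])⁻¹ * F σ)
    (hν : ∀ χ : G →* ℂ_[2]ˣ, χ.comp I.subtype = θ →
      ∑ σ, (χ σ : ℂ_[2])⁻¹ * ν σ = c * (χ γ₀ : ℂ_[2])⁻¹ * ∑ g, (χ g : ℂ_[2]) * L g) :
    ∑ σ, F σ * ν σ = c * ∑ g, F (γ₀ * g⁻¹) * L g := by
  haveI : NeZero ((Monoid.exponent G : ℕ) : ℂ_[2]) :=
    ⟨Nat.cast_ne_zero.mpr Monoid.exponent_ne_zero_of_finite⟩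
  exact isotypic_transfer I θ F ν L c γ₀ hF hν

end PadicComplexInstance

end Literature.GroupTheory.FiniteAbelian
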